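import Literature.NumberTheory.Sieve.LinearEquationsInPrimesLevelTwoSharp
import Literature.NumberTheory.Sieve.LinearEquationsInPrimesHeisenbergBoxMetric
import HarnessLib

/-!
# Linear equations in primes, level 2: the rung from `GI(2)` and `MN(2)` alone

Trunk T-SIEVE (`Literature/NumberTheory/Sieve`). The F1 interface theorems of the level-2 rung of
Green–Tao's *Linear equations in primes* (Ann. of Math. 171 (2010), Thm. 7.2 and Main Theorem at
`s = 2`): with the explicit metric (`GreenTaoLevelTwo.HeisMetricExists_holds`,
`LinearEquationsInPrimesHeisenbergBoxMetric.lean`) and the sharp estimate (12.6)₂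
(`GreenTaoLevelTwo.SharpTwo_holds`, `LinearEquationsInPrimesLevelTwoSharp.lean`) PROVED, the two
deep inputs on the Heisenberg class — `GITwo` (the `U³[N]` inverse theorem, Green–Tao 2008a
Thm. 12.8 / GT2010 Prop. 8.4) and `MNTwo` (Möbius ⟂ 2-step nilsequences, Green–Tao 2008b Thm. 1.1)
— alone give `GreenTao2010_gowersUniformityAt 2` and the Main Theorem for every finite-complexity
system of `t ≤ 4` affine-linear forms (in particular the Hardy–Littlewood asymptotic for 4-term
progressions of primes).

## References

* B. Green, T. Tao, *Linear equations in primes*, Ann. of Math. (2) 171 (2010): Thm. 7.2, §12,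
  Main Theorem (Thm. 1.8). [GreenTao2010]
-/

noncomputable section

namespace Literature.NumberTheory.Sieve

open GreenTaoLevelTwo in
/-- **Level 2 of Thm. 7.2 from `GI(2)` and `MN(2)` on the Heisenberg class** (the metric and
(12.6)₂ being theorems of the tree). [cite: GreenTao2010, Thm. 7.2 (proof, §12)] -/
theorem GreenTao2010_gowersUniformityAt_two_of_GI_of_MN (hGI : GITwo) (hMN : MNTwo) :
    GreenTao2010_gowersUniformityAt 2 :=
  GreenTao2010_gowersUniformityAt_two_of_metric_of_GI_of_MN HeisMetricExists_holds hGI hMN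

open GreenTaoLevelTwo in
/-- **The level-2 rung**: `GI(2)` and `MN(2)` on the Heisenberg class give the Main Theorem of
Green–Tao 2010 for every finite-complexity system of `t ≤ 4` affine-linear forms — in particular
the Hardy–Littlewood asymptotic for 4-term progressions of primes.
[cite: GreenTao2010, Main Theorem and Thm. 7.2] -/
theorem GreenTao2010_mainTheorem_of_le_four_of_GI_of_MN (hGI : GITwo) (hMN : MNTwo) :
    MainTheoremLeFour :=
  GreenTao2010_mainTheorem_of_le_four_of_metric_of_GI_of_MN HeisMetricExists_holds hGI hMN

end Literature.NumberTheory.Sieve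

end
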